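import Summits.HodgeConjecture.CorCM.Census.DecicWeil23PairTwoTransitive
import Summits.HodgeConjecture.CorCM.DecicWeil23PairFrameTransfer
import Summits.HodgeConjecture.CorCM.DecicWeil23PairRealisers
import HarnessLib

/-!
# COR-CM — two `(2,3)`-types over one DECIC CM field: FRAME TRANSFER under `2`-TRANSITIVITY — the realised permutations of the
# five conjugate pairs form a composition-closed `2`-transitive set, every Galois-balanced weight is balanced under it, hence
# satisfies all sixty `A₅`-equations of the kernel census

Cell `pub-hodgecm2` (COR-CM), seat b30 gen 23 (2026-08-22); count-neutral own lane DECIC-2T (gen 22's NEXT SIZED ITEM), over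
`Census/DecicWeil23PairTwoTransitive` (the defect law from `2`-transitivity).  Theorems, plus ONE bookkeeping definition (the
finset `realisedPerms e` of permutations of the pairs induced by automorphisms of `ℂ`); no named fact, no `sorry`.

SETTING: that of `CorCM/DecicWeil23PairFrameTransfer` (family `Kf`, slots `pairSlots i₀ i₁ = (k, K, K)`, frame
`e : Hom(K, ℂ) ≃ Fin 5 × Bool` with `he_sign` / `he_conj`, types read at the positions `inPos c m`, model map `toPtD`).  Gen 22
transferred Galois-balance to the model through the SIXTY tabulated even permutations `permD r`, each assumed realised (`hgal`,
from `3`-transitivity).  Here the transfer is TAUTOLOGICAL — a Galois-balanced weight is balanced under every realised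
permutation, whatever they are (`modelBalancedP_of_isGaloisBalancedAlg`, NO Galois hypothesis) — and the Galois input enters only
through the abstract defect law: the realised permutations are closed under composition and inverse (§2) and, as soon as `Aut(ℂ)`
moves every ordered pair of distinct conjugate pairs to `(0, 1)` (`h2t`: the totally real quintic `K⁺` has `2`-TRANSITIVE Galois
group — `S₅`, `A₅` or the Frobenius group `F₂₀`), `2`-transitive; so `Census/DecicWeil23PairTwoTransitive.modelBalancedD_of_modelBalancedP`
yields gen 22's `ModelBalancedD` (**`modelBalancedD_of_isGaloisBalancedAlg_h2t`**, §3) and every downstream file applies BY NAME.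
§4: the frame form `h2t` from the intrinsic `2`-transitivity (`h2t_of_twoTransitive`) and from gen 22's `h3t` (`h2t_of_h3t`).
HONEST FRAMING: nothing about the Hodge conjecture is concluded here; `HC_CM` is not asserted.
[cite: Shimura1998, §18.2 Lemma (i)] [cite: GaoUllmo2025, Thm 3.1 (3.2)] [cite: Pohlmann1968, Thm 1] [cite: DixonMortimer1996, §2.1]

## References
* [Shimura1998] G. Shimura, *Abelian varieties with complex multiplication and modular functions*, §18.2 Lemma (i).
  [GaoUllmo2025] Z. Gao, E. Ullmo, J. Inst. Math. Jussieu 25 (2025), Thm 3.1 (3.2).  [Pohlmann1968] H. Pohlmann, Ann. of Math.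
  88 (1968), Thm 1.  [DixonMortimer1996] J. D. Dixon, B. Mortimer, *Permutation Groups*, GTM 163 (1996), §2.1.
-/

noncomputable section

open CategoryTheory CategoryTheory.Limits NumberField

namespace Summit.HodgeConjecture.CorCM.DecicWeil23Pair

open Literature.AlgebraicGeometry Literature.AlgebraicGeometry.Motives Literature.AlgebraicGeometry.HodgeTheory
open Literature.AlgebraicGeometry.Pohlmann1968
open Literature.NumberTheory.ComplexMultiplication
open Summit.HodgeConjecture.CorCM.Census.DecicWeil23Pair (PtD inPos phiP inl_mem_phiP inr_mem_phiP ModelBalancedP ModelBalancedD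
  modelBalancedD_of_modelBalancedP)
open Summit.HodgeConjecture.CorCM.OcticCurveFourfold (comp_injective comp_conjugate)
open Summit.HodgeConjecture.CorCM.DihedralSexticPairCurvePowers (ncard_sep_eq_card_filter)

open scoped Classical

/-! ## §1 How a realiser of an ARBITRARY permutation of the pairs acts -/

section Realises

variable {I : Type} {Kf : I → Type} [∀ i, Field (Kf i)]
  {i₀ i₁ : I} {e : (Kf i₁ →+* ℂ) ≃ Fin 5 × Bool} {τ : Kf i₀ →+* ℂ}
  (hττ : ComplexEmbedding.conjugate τ ≠ τ) (hk : ∀ σ : Kf i₀ →+* ℂ, σ = τ ∨ σ = ComplexEmbedding.conjugate τ)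
  {i : Kf i₀ →+* Kf i₁}
  (he_sign : ∀ s : Kf i₁ →+* ℂ, (e s).2 = true ↔ s.comp i = τ)
  (he_conj : ∀ s : Kf i₁ →+* ℂ, e (ComplexEmbedding.conjugate s) = ((e s).1, !(e s).2))

include he_conj in
/-- **A realiser of the permutation `π` acts on the frame by `e (ρ ∘ s) = (π (e s).1, (e s).2)`** (it keeps the member over `τ`
and commutes with complex conjugation). [cite: Shimura1998, §18.2 Lemma (i)] -/
theorem apply_comp_eq_of_realises [NumberField (Kf i₁)] [IsCMField (Kf i₁)] (ρ : ℂ ≃+* ℂ) {π : Equiv.Perm (Fin 5)}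
    (hρ : ∀ a : Fin 5, (ρ : ℂ →+* ℂ).comp (e.symm (a, true)) = e.symm (π a, true)) (s : Kf i₁ →+* ℂ) :
    e ((ρ : ℂ →+* ℂ).comp s) = (π (e s).1, (e s).2) := by
  cases h2 : (e s).2
  · have hs : s = ComplexEmbedding.conjugate (e.symm ((e s).1, true)) := by
      apply e.injective
      rw [he_conj, Equiv.apply_symm_apply]
      exact Prod.ext rfl (by rw [h2]; rfl)
    rw [hs, comp_conjugate ρ, he_conj, hρ, Equiv.apply_symm_apply, ← hs]
    rfl
  · have hs : s = e.symm ((e s).1, true) := by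
      apply e.injective
      rw [Equiv.apply_symm_apply]
      exact Prod.ext rfl h2
    rw [hs, hρ, Equiv.apply_symm_apply, ← hs]

include he_sign in
/-- **A realiser of `π` fixes `τ`.** [cite: Shimura1998, §18.2 Lemma (i)] -/
theorem comp_tau_eq_of_realises (ρ : ℂ ≃+* ℂ) {π : Equiv.Perm (Fin 5)}
    (hρ : ∀ a : Fin 5, (ρ : ℂ →+* ℂ).comp (e.symm (a, true)) = e.symm (π a, true)) : (ρ : ℂ →+* ℂ).comp τ = τ := by
  have h0 : (e.symm ((0 : Fin 5), true)).comp i = τ := (he_sign _).1 (by rw [Equiv.apply_symm_apply])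
  have h1 : (e.symm (π 0, true)).comp i = τ := (he_sign _).1 (by rw [Equiv.apply_symm_apply])
  calc (ρ : ℂ →+* ℂ).comp τ = ((ρ : ℂ →+* ℂ).comp (e.symm (0, true))).comp i := by rw [RingHom.comp_assoc, h0]
    _ = τ := by rw [hρ, h1]

include hττ hk he_sign in
/-- Hence on `Hom(k, ℂ) = {τ, τ̄}`: `ρ ∘ σ = τ ⟺ σ = τ`. [folklore] -/
theorem comp_eq_tau_iff_of_realises (ρ : ℂ ≃+* ℂ) {π : Equiv.Perm (Fin 5)}
    (hρ : ∀ a : Fin 5, (ρ : ℂ →+* ℂ).comp (e.symm (a, true)) = e.symm (π a, true)) (σ : Kf i₀ →+* ℂ) :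
    (ρ : ℂ →+* ℂ).comp σ = τ ↔ σ = τ := by
  have hρτ := comp_tau_eq_of_realises he_sign ρ hρ
  rcases hk σ with rfl | rfl
  · exact ⟨fun _ => rfl, fun _ => hρτ⟩
  · constructor
    · intro h
      exact absurd (comp_injective (K := Kf i₀) ρ (h.trans hρτ.symm)) hττ
    · intro h
      exact absurd h hττ

variable {c : Bool} {Φ₃ : ∀ j : Fin 3, CMType (Kf (pairSlots i₀ i₁ j))}
  (hΦ : ∀ (m : Fin 2) (s : Kf i₁ →+* ℂ), s ∈ (Φ₃ m.succ).1 ↔ (e s).2 = inPos c m (e s).1)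
  (hΨ : ∀ σ : Kf i₀ →+* ℂ, σ ∈ (Φ₃ 0).1 ↔ σ = τ)

include hττ hk he_sign he_conj hΦ hΨ in
/-- **Membership read in the frame**: for a realiser `ρ` of `π`, `ρ ∘ x ∈ Φ₃ ↔ toPtD x ∈ phiP c π` (the type read through `π`).
[cite: GaoUllmo2025, Thm 3.1 (3.2)] -/
theorem comp_mem_iff_toPtD_mem_phiP [NumberField (Kf i₁)] [IsCMField (Kf i₁)] {ρ : ℂ ≃+* ℂ} {π : Equiv.Perm (Fin 5)}
    (hρ : ∀ a : Fin 5, (ρ : ℂ →+* ℂ).comp (e.symm (a, true)) = e.symm (π a, true))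
    (x : (j : Fin 3) × (Kf (pairSlots i₀ i₁ j) →+* ℂ)) :
    (ρ : ℂ →+* ℂ).comp x.2 ∈ (Φ₃ x.1).1 ↔ toPtD e τ x ∈ phiP c π := by
  rcases sigma_casesD x with ⟨σ, rfl⟩ | ⟨m, s, rfl⟩
  · change (ρ : ℂ →+* ℂ).comp σ ∈ (Φ₃ 0).1 ↔ _
    rw [hΨ, toPtD_zero, inl_mem_phiP, comp_eq_tau_iff_of_realises hττ hk he_sign ρ hρ σ]
    exact ⟨fun h => decide_eq_true h, fun h => of_decide_eq_true h⟩
  · change (ρ : ℂ →+* ℂ).comp s ∈ (Φ₃ m.succ).1 ↔ _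
    rw [hΦ, toPtD_succ, apply_comp_eq_of_realises he_conj ρ hρ s, inr_mem_phiP]

end Realises

/-! ## §2 The realised permutations: closed under composition and inverse; `2`-transitive under `h2t` -/

section Realised

variable {F k : Type} [Field F] [Field k]

/-- **The realised permutations of the five conjugate pairs**: those `π` induced by some automorphism `ρ` of `ℂ`
(`ρ ∘ e⁻¹(a, true) = e⁻¹(π a, true)` for all `a`). [cite: Shimura1998, §18.2 Lemma (i)] -/
def realisedPerms (e : (F →+* ℂ) ≃ Fin 5 × Bool) : Finset (Equiv.Perm (Fin 5)) :=
  Finset.univ.filter fun π => ∃ ρ : ℂ ≃+* ℂ, ∀ a : Fin 5, (ρ : ℂ →+* ℂ).comp (e.symm (a, true)) = e.symm (π a, true)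

variable (e : (F →+* ℂ) ≃ Fin 5 × Bool)

/-- Membership in `realisedPerms e`. [folklore] -/
theorem mem_realisedPerms (π : Equiv.Perm (Fin 5)) :
    π ∈ realisedPerms e ↔ ∃ ρ : ℂ ≃+* ℂ, ∀ a : Fin 5, (ρ : ℂ →+* ℂ).comp (e.symm (a, true)) = e.symm (π a, true) := by
  simp [realisedPerms]

/-- **Closed under composition** (compose the automorphisms). [folklore] -/
theorem mul_mem_realisedPerms : ∀ π₁ ∈ realisedPerms e, ∀ π₂ ∈ realisedPerms e, π₁ * π₂ ∈ realisedPerms e := by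
  intro π₁ h₁ π₂ h₂
  obtain ⟨ρ₁, h₁⟩ := (mem_realisedPerms e π₁).1 h₁
  obtain ⟨ρ₂, h₂⟩ := (mem_realisedPerms e π₂).1 h₂
  refine (mem_realisedPerms e _).2 ⟨ρ₂.trans ρ₁, fun a => ?_⟩
  rw [RingEquiv.coe_ringHom_trans, RingHom.comp_assoc, h₂ a, h₁ (π₂ a), Equiv.Perm.mul_apply]

/-- **Closed under inverse** (invert the automorphism). [folklore] -/
theorem inv_mem_realisedPerms : ∀ π ∈ realisedPerms e, π⁻¹ ∈ realisedPerms e := by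
  intro π h
  obtain ⟨ρ, h⟩ := (mem_realisedPerms e π).1 h
  refine (mem_realisedPerms e _).2 ⟨ρ.symm, fun a => ?_⟩
  have key := h (π⁻¹ a)
  rw [show π (π⁻¹ a) = a from (Equiv.apply_eq_iff_eq_symm_apply π).mpr rfl] at key
  rw [← key, ← RingHom.comp_assoc]
  have : ((ρ.symm : ℂ ≃+* ℂ) : ℂ →+* ℂ).comp (ρ : ℂ →+* ℂ) = RingHom.id ℂ := RingHom.ext fun z => ρ.symm_apply_apply z
  rw [this, RingHom.id_comp]

variable {e} {τ : k →+* ℂ} {i : k →+* F} (he_sign : ∀ s : F →+* ℂ, (e s).2 = true ↔ s.comp i = τ)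

include he_sign in
/-- **An automorphism moving `(a, b)` to `(0, 1)` yields a realised permutation with `π a = 0`, `π b = 1`** (it fixes `τ`, hence
permutes the pairs: `exists_perm_of_comp_tau_eq₅`). [cite: Shimura1998, §18.2 Lemma (i)] -/
theorem exists_mem_realisedPerms_of_moves {a b : Fin 5} {ρ : ℂ ≃+* ℂ}
    (ha : (ρ : ℂ →+* ℂ).comp (e.symm (a, true)) = e.symm (0, true))
    (hb : (ρ : ℂ →+* ℂ).comp (e.symm (b, true)) = e.symm (1, true)) :
    ∃ π ∈ realisedPerms e, π a = 0 ∧ π b = 1 := by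
  have hρτ : (ρ : ℂ →+* ℂ).comp τ = τ := by
    have ha' : (e.symm (a, true)).comp i = τ := (he_sign _).1 (by rw [Equiv.apply_symm_apply])
    have h0 : (e.symm ((0 : Fin 5), true)).comp i = τ := (he_sign _).1 (by rw [Equiv.apply_symm_apply])
    calc (ρ : ℂ →+* ℂ).comp τ = ((ρ : ℂ →+* ℂ).comp (e.symm (a, true))).comp i := by rw [RingHom.comp_assoc, ha']
      _ = τ := by rw [ha, h0]
  obtain ⟨π, hπ⟩ := exists_perm_of_comp_tau_eq₅ he_sign ρ hρτ
  refine ⟨π, (mem_realisedPerms e π).2 ⟨ρ, hπ⟩, ?_, ?_⟩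
  · exact (Prod.mk.inj (e.symm.injective ((hπ a).symm.trans ha))).1
  · exact (Prod.mk.inj (e.symm.injective ((hπ b).symm.trans hb))).1

include he_sign in
/-- **`2`-TRANSITIVITY of the realised permutations under `h2t`**: if every ordered pair of distinct conjugate pairs is moved to
`(0, 1)` by an automorphism of `ℂ`, then for `a ≠ b`, `x ≠ y` some realised `π` has `π a = x`, `π b = y`
(`π = π_{xy}⁻¹ ∘ π_{ab}`). [cite: DixonMortimer1996, §2.1] -/
theorem twoTransitive_realisedPerms
    (h2t : ∀ a b : Fin 5, a ≠ b → ∃ ρ : ℂ ≃+* ℂ,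
      (ρ : ℂ →+* ℂ).comp (e.symm (a, true)) = e.symm (0, true) ∧ (ρ : ℂ →+* ℂ).comp (e.symm (b, true)) = e.symm (1, true)) :
    ∀ a b x y : Fin 5, a ≠ b → x ≠ y → ∃ π ∈ realisedPerms e, π a = x ∧ π b = y := by
  intro a b x y hab hxy
  obtain ⟨ρ₁, h₁a, h₁b⟩ := h2t a b hab
  obtain ⟨ρ₂, h₂x, h₂y⟩ := h2t x y hxy
  obtain ⟨π₁, hπ₁, hπ₁a, hπ₁b⟩ := exists_mem_realisedPerms_of_moves he_sign h₁a h₁b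
  obtain ⟨π₂, hπ₂, hπ₂x, hπ₂y⟩ := exists_mem_realisedPerms_of_moves he_sign h₂x h₂y
  refine ⟨π₂⁻¹ * π₁, mul_mem_realisedPerms e _ (inv_mem_realisedPerms e _ hπ₂) _ hπ₁, ?_, ?_⟩
  · rw [Equiv.Perm.mul_apply, hπ₁a, ← hπ₂x]
    exact π₂.symm_apply_apply x
  · rw [Equiv.Perm.mul_apply, hπ₁b, ← hπ₂y]
    exact π₂.symm_apply_apply y

end Realised

/-! ## §3 Frame transfer: Galois-balanced ⟹ balanced under the realised permutations ⟹ (under `h2t`) `ModelBalancedD` -/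

section Transfer

variable {I : Type} {Kf : I → Type} [∀ i, Field (Kf i)]
  {i₀ i₁ : I} {e : (Kf i₁ →+* ℂ) ≃ Fin 5 × Bool} {τ : Kf i₀ →+* ℂ}
  (hττ : ComplexEmbedding.conjugate τ ≠ τ) (hk : ∀ σ : Kf i₀ →+* ℂ, σ = τ ∨ σ = ComplexEmbedding.conjugate τ)
  {i : Kf i₀ →+* Kf i₁}
  (he_sign : ∀ s : Kf i₁ →+* ℂ, (e s).2 = true ↔ s.comp i = τ)
  (he_conj : ∀ s : Kf i₁ →+* ℂ, e (ComplexEmbedding.conjugate s) = ((e s).1, !(e s).2))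
  {c : Bool} {Φ₃ : ∀ j : Fin 3, CMType (Kf (pairSlots i₀ i₁ j))}
  (hΦ : ∀ (m : Fin 2) (s : Kf i₁ →+* ℂ), s ∈ (Φ₃ m.succ).1 ↔ (e s).2 = inPos c m (e s).1)
  (hΨ : ∀ σ : Kf i₀ →+* ℂ, σ ∈ (Φ₃ 0).1 ↔ σ = τ)
  {N : ℕ} (κ : Fin N → Fin 3)

include hττ hk he_sign he_conj hΦ hΨ in
/-- **FRAME TRANSFER, no Galois hypothesis**: an `Aut(ℂ)`-balanced weight of `X = ⨁_j A₃(κ j)` is balanced, in the model of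
`Census/DecicWeil23Pair`, under EVERY realised permutation of the pairs (`ModelBalancedP` for `realisedPerms e`): the balance
condition of a realiser `ρ` of `π` is the model equation at `π`. [cite: GaoUllmo2025, Thm 3.1 (3.2)] [cite: Pohlmann1968, Thm 1] -/
theorem modelBalancedP_of_isGaloisBalancedAlg [NumberField (Kf i₁)] [IsCMField (Kf i₁)]
    {S : Finset ((j : Fin N) × (Kf (pairSlots i₀ i₁ (κ j)) →+* ℂ))}
    (hS : IsGaloisBalancedAlg (K := fun j => Kf (pairSlots i₀ i₁ (κ j))) (fun j => Φ₃ (κ j)) S) :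
    ModelBalancedP c (realisedPerms e) (fun x => toPtD e τ ((Sigma.map κ (fun _ => id) :
      ((j : Fin N) × (Kf (pairSlots i₀ i₁ (κ j)) →+* ℂ)) → ((m : Fin 3) × (Kf (pairSlots i₀ i₁ m) →+* ℂ))) x)) S := by
  intro π hπ
  beta_reduce
  obtain ⟨ρ, hρ⟩ := (mem_realisedPerms e π).1 hπ
  have h := hS ρ
  rw [ncard_sep_eq_card_filter, ncard_sep_eq_card_filter] at h
  have key : ∀ x : (j : Fin N) × (Kf (pairSlots i₀ i₁ (κ j)) →+* ℂ),
      (ρ : ℂ →+* ℂ).comp x.2 ∈ (Φ₃ (κ x.1)).1 ↔ toPtD e τ ((Sigma.map κ (fun _ => id) :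
        ((j : Fin N) × (Kf (pairSlots i₀ i₁ (κ j)) →+* ℂ)) → ((m : Fin 3) × (Kf (pairSlots i₀ i₁ m) →+* ℂ))) x)
          ∈ phiP c π :=
    fun x => comp_mem_iff_toPtD_mem_phiP hττ hk he_sign he_conj hΦ hΨ hρ ⟨κ x.1, x.2⟩
  rw [Finset.filter_congr fun x _ => key x, Finset.filter_congr fun x _ => (key x).not] at h
  have htot := Finset.card_filter_add_card_filter_not
    (s := S) (fun x => toPtD e τ ((Sigma.map κ (fun _ => id) :
        ((j : Fin N) × (Kf (pairSlots i₀ i₁ (κ j)) →+* ℂ)) → ((m : Fin 3) × (Kf (pairSlots i₀ i₁ m) →+* ℂ))) x)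
          ∈ phiP c π)
  omega

include hττ hk he_sign he_conj hΦ hΨ in
/-- **FRAME TRANSFER under `2`-TRANSITIVITY**: if `Aut(ℂ)` moves every ordered pair of distinct conjugate pairs to `(0, 1)`
(`h2t`), an `Aut(ℂ)`-balanced weight of `X = ⨁_j A₃(κ j)` satisfies ALL SIXTY `A₅`-equations `ModelBalancedD` of gen 22's
census (realised permutations: composition-closed and `2`-transitive; defect law; signed equation at every even permutation) —
the hypothesis `hgal` of `modelBalancedD_of_isGaloisBalancedAlg` is not needed. [cite: GaoUllmo2025, Thm 3.1 (3.2)]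
[cite: Pohlmann1968, Thm 1] [cite: DixonMortimer1996, §2.1] -/
theorem modelBalancedD_of_isGaloisBalancedAlg_h2t [NumberField (Kf i₁)] [IsCMField (Kf i₁)]
    (h2t : ∀ a b : Fin 5, a ≠ b → ∃ ρ : ℂ ≃+* ℂ,
      (ρ : ℂ →+* ℂ).comp (e.symm (a, true)) = e.symm (0, true) ∧ (ρ : ℂ →+* ℂ).comp (e.symm (b, true)) = e.symm (1, true))
    {S : Finset ((j : Fin N) × (Kf (pairSlots i₀ i₁ (κ j)) →+* ℂ))}
    (hS : IsGaloisBalancedAlg (K := fun j => Kf (pairSlots i₀ i₁ (κ j))) (fun j => Φ₃ (κ j)) S) :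
    ModelBalancedD c (fun x => toPtD e τ ((Sigma.map κ (fun _ => id) :
      ((j : Fin N) × (Kf (pairSlots i₀ i₁ (κ j)) →+* ℂ)) → ((m : Fin 3) × (Kf (pairSlots i₀ i₁ m) →+* ℂ))) x)) S :=
  modelBalancedD_of_modelBalancedP (mul_mem_realisedPerms e) (twoTransitive_realisedPerms he_sign h2t)
    (modelBalancedP_of_isGaloisBalancedAlg hττ hk he_sign he_conj hΦ hΨ κ hS)

end Transfer

/-! ## §4 The frame form `h2t` from the intrinsic `2`-transitivity, and from `3`-transitivity -/

section Intrinsic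

variable {K : Type} [Field K] {k : Type} [Field k] {e : (K →+* ℂ) ≃ Fin 5 × Bool} {i : k →+* K} {τ : k →+* ℂ}

/-- **`2`-transitivity, intrinsic ⟹ frame form**: if `Aut(ℂ)` moves every injective pair of embeddings of `K` over `τ` to every
other (`h2T`), then every ordered pair of distinct labels is moved to `(0, 1)` (`h2t`). [folklore] -/
theorem h2t_of_twoTransitive (he_sign : ∀ s, (e s).2 = true ↔ s.comp i = τ)
    (h2T : ∀ x y : Fin 2 ↪ {s : K →+* ℂ // s.comp i = τ}, ∃ ρ : ℂ ≃+* ℂ, ∀ j : Fin 2, (ρ : ℂ →+* ℂ).comp (x j).1 = (y j).1)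
    (a b : Fin 5) (hab : a ≠ b) :
    ∃ ρ : ℂ ≃+* ℂ, (ρ : ℂ →+* ℂ).comp (e.symm (a, true)) = e.symm (0, true) ∧
      (ρ : ℂ →+* ℂ).comp (e.symm (b, true)) = e.symm (1, true) := by
  have hover : ∀ a : Fin 5, (e.symm (a, true)).comp i = τ := fun a => (he_sign _).1 (by rw [Equiv.apply_symm_apply])
  have hemb : ∀ a b : Fin 5, a ≠ b →
      Function.Injective (![⟨e.symm (a, true), hover a⟩, ⟨e.symm (b, true), hover b⟩] : Fin 2 → {s : K →+* ℂ // s.comp i = τ}) := by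
    intro a b hab j j' h
    have key : ∀ u w : Fin 5, (⟨e.symm (u, true), hover u⟩ : {s : K →+* ℂ // s.comp i = τ}) = ⟨e.symm (w, true), hover w⟩ →
        u = w := fun u w huw => (Prod.mk.inj (e.symm.injective (congrArg Subtype.val huw))).1
    fin_cases j <;> fin_cases j'
    · rfl
    · exact absurd (key _ _ h) hab
    · exact absurd (key _ _ h).symm hab
    · rfl
  obtain ⟨ρ, hρ⟩ := h2T ⟨_, hemb a b hab⟩ ⟨_, hemb 0 1 (by decide)⟩
  exact ⟨ρ, hρ 0, hρ 1⟩

/-- **`3`-transitivity ⟹ `2`-transitivity (frame forms)**: gen 22's hypothesis `h3t` implies `h2t` (move `(a, b, c)` to `(0, 1, 2)`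
for any third pair `c`). [folklore] -/
theorem h2t_of_h3t
    (h3t : ∀ a b c : Fin 5, a ≠ b → a ≠ c → b ≠ c → ∃ ρ : ℂ ≃+* ℂ,
      (ρ : ℂ →+* ℂ).comp (e.symm (a, true)) = e.symm (0, true) ∧ (ρ : ℂ →+* ℂ).comp (e.symm (b, true)) = e.symm (1, true) ∧
        (ρ : ℂ →+* ℂ).comp (e.symm (c, true)) = e.symm (2, true))
    (a b : Fin 5) (hab : a ≠ b) :
    ∃ ρ : ℂ ≃+* ℂ, (ρ : ℂ →+* ℂ).comp (e.symm (a, true)) = e.symm (0, true) ∧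
      (ρ : ℂ →+* ℂ).comp (e.symm (b, true)) = e.symm (1, true) := by
  obtain ⟨c, hac, hbc⟩ : ∃ c : Fin 5, a ≠ c ∧ b ≠ c := by
    have key : ∀ a b : Fin 5, ∃ c : Fin 5, a ≠ c ∧ b ≠ c := by decide
    exact key a b
  obtain ⟨ρ, ha, hb, -⟩ := h3t a b c hab hac hbc
  exact ⟨ρ, ha, hb⟩

end Intrinsic

end Summit.HodgeConjecture.CorCM.DecicWeil23Pair

end
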